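/-
Copyright (c) 2026 the pub-hodgecm-mathlib formalisation cell (harness21).  Prover seat hodgecm-mathlib-LH4-p11 (g12) for section S6 (dealer R90-C14-plan (g3), deal
04:13:05Z via chair K2-lead (g2) VALVE 45), programme R90-TF, 2026-09-05.
-/
import Literature.FieldTheory.FiniteFields.HermitianSphereCount       -- ★ `natCard_norm_eq` (`#{x : σ x · x = e} = q + 1`), `frob_norm`, `frob_frob` (the `q`-Frobenius frame of `𝔽_{q²} ∕ 𝔽_q`)
import Literature.FieldTheory.FiniteFields.QuadraticTraceKernelCount  -- ★ `natCard_frobFixed` (`#{x : σ x = x} = q`)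
import HarnessLib

/-!
# R90 · S6 «Ch. 14.1–14.5 stable trace formula» — (T4-VAL-b) NEW-3: THE RESIDUE-FIELD COUNT BEHIND (T4.8)'s `(q + 1)²` — «THE HERMITIAN PLANE RESIDUE COUNT»
# `#{(x, y) ∈ 𝓀² : ω₀ + ω₁·N(x) + ω₂·N(y) = 0} = (q + 1)²` for pairwise `k_F`-independent `ω₀, ω₁, ω₂ ∈ 𝓀 = 𝔽_{q²}` (`Theorems/R90S6HermitianPlaneResidueCount.lean`)

Cell `hodgecm-mathlib`, crux H413 (`stmt-HodgeConjecture-24833`), route of record `HCCMUnconditional`; programme R90-TF, section S6 (base `R90-C14`, dealer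
R90-C14-plan (g3)), seat LH4-p11 (g12) (routed by chair K2-lead (g2) VALVE 45 (zz)); card (T4-VAL-b) NEW-3 of R90-C14-p07 (g2)'s census 04:12:14Z («all `c_i` odd ⇒
`#Shell(δ′, (1,0,0)) = (q+1)²`», sheet v2.3 :314 (T4.8)), cut by the dealer 04:13:05Z as a brick p07's FILE 1 IMPORTS.  Lane `--kind proof --supports stmt-HodgeConjecture-24833
--as helper`; THEOREMS ONLY (no definition, no instance, no notation, no named fact, no kit, no `sorry`); imports = the two ★ Literature finite-field files + HarnessLib.

THE FRAME (★ `Literature/FieldTheory/FiniteFields/HermitianSphereCount.lean` VERBATIM): `k` a finite field with `Fintype.card k = q ^ 2`, `σ : k →+* k` with `σ x = x ^ q` (the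
`q`-Frobenius, an involution ★ `frob_frob`), the «norm» `N x := σ x * x` (★'s byte order), which is `σ`-fixed (★ `frob_norm`); the fixed field `k_F = 𝔽_q` is NOT a type of the
frame — it is spelled pointwise `σ e = e` (★ `natCard_norm_eq … (he : σ e = e) (he0 : e ≠ 0) : Nat.card {x : k // σ x * x = e} = q + 1`, ★ `natCard_frobFixed :
Nat.card {x : k // σ x = x} = q`).  Accordingly «`ωᵢ, ωⱼ` are `k_F`-linearly independent» is spelled with σ-FIXED COEFFICIENTS:
`∀ a b : k, σ a = a → σ b = b → a * ωᵢ + b * ωⱼ = 0 → a = 0 ∧ b = 0` (binders `h01 h02 h12`).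
THE CONTENT (elementary linear algebra over `𝔽_q` + Wilson's norm-fibre count):
* §1 `exists_fixedPair_of_pairwise_linearIndependent` — there are σ-fixed `a, b`, BOTH NON-ZERO, with `ω₀ + a·ω₁ + b·ω₂ = 0`, and the σ-fixed pair is UNIQUE: the map
  `Φ : k_F × k_F → k, (a, b) ↦ a·ω₁ + b·ω₂` is injective by `h12` (σ-fixed differences) and `#(k_F × k_F) = q·q = #k` (★ `natCard_frobFixed`), so `Φ` is a bijection
  (Mathlib `Function.Injective.bijective_of_nat_card_le`) and `(a, b) := Φ⁻¹(−ω₀)`; `a ≠ 0` by `h02` with the σ-fixed coefficient `1`, `b ≠ 0` by `h01`.  Packaged also as the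
  dealer's (H.1) `existsUnique_pair_of_pairwise_linearIndependent` (`∃!` over `{x // σ x = x} × {x // σ x = x}`) and `pair_ne_zero_of_pairwise_linearIndependent`.
* §2 HEAD (H.2) `natCard_setOf_add_mul_norm_add_mul_norm_eq_zero` — the fibre `{(x, y) : ω₀ + ω₁·N(x) + ω₂·N(y) = 0}` IS `{x : N x = a} × {y : N y = b}` (norms are σ-fixed, so
  the σ-fixed pair `(N x, N y)` is THE pair `(a, b)` of §1), hence has `(q + 1)·(q + 1)` points by ★ `natCard_norm_eq` twice (`a, b ≠ 0`).
CONSUMER: R90-C14-p07 (g2)'s FILE 1 `Theorems/R90S6TwistedFirstShellPlaneLayer.lean` §2∕§3 (`ωᵢ :=` the residues of the diagonal units of the apartment frame; the residue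
count via ★ `HermitianSphereCount.natCard_norm_eq` ×2 + the `k_F`-basis `(ω̄₁, ω̄₂)` from `hdepth`) → its HEAD (P) `ncard_twistedShell_one_zero_zero_inter_firstShell_eq_sq` →
(T4.8).
HONEST LABEL: a finite-field count, count-neutral; it becomes (T4.8)'s value only through p07's FILE 1∕2 + FILE 3 + the socket; proves no printed global statement, discharges
no citation; HC_CM is proved only modulo the 7 printed citations (2 remaining named inputs: hLiu418 = `stmt-HodgeConjecture-24832`, h413 = `stmt-HodgeConjecture-24833`) until
rung 0 closes.  REL ≠ ★ ≠ BUILT.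

## References
* [Wilson2009] R. A. Wilson, *The Finite Simple Groups*, GTM 251 (2009): §3.6 p. 66, (3.25) (norm fibres of `𝔽_{q²} ∕ 𝔽_q` have `q + 1` points).
* [LidlNiederreiter1996] R. Lidl, H. Niederreiter, *Finite Fields*, 2nd ed. (1997): Thm. 2.23 (iii) (the fixed field of the `q`-Frobenius of `𝔽_{q²}` is `𝔽_q`), Thm. 2.28
  (the norm `𝔽_{q²} → 𝔽_q` is onto).
* [Rogawski1990] J. D. Rogawski, *Automorphic Representations of Unitary Groups in Three Variables*, Ann. of Math. Stud. 123 (1990): §4.9 Prop. 4.9.1 (b) pp. 54–55 (the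
  lattice counts these residue numbers feed).
-/

set_option autoImplicit false
-- the mandated namespace repeats the single-problem summit's segment (`HodgeConjecture.HodgeConjecture`)
set_option linter.dupNamespace false

noncomputable section

open Literature.FieldTheory.FiniteFields (natCard_norm_eq natCard_frobFixed frob_norm)

namespace Summit.HodgeConjecture.HodgeConjecture.R90.S6

variable {k : Type*} [Field k] [Fintype k] {q : ℕ}

/-! ### §1 The unique σ-fixed pair `(a, b)` with `ω₀ + a·ω₁ + b·ω₂ = 0`, both non-zero -/

/-- **§1 — THE σ-FIXED PAIR (flat form).**  In `𝓀 = 𝔽_{q²}` with `q`-Frobenius `σ`, let `ω₀, ω₁, ω₂` be pairwise `𝔽_q`-linearly independent (σ-fixed-coefficient spelling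
`h01 h02 h12`).  Then there are σ-fixed `a, b`, BOTH NON-ZERO, with `ω₀ + a·ω₁ + b·ω₂ = 0`, and the σ-fixed pair `(a, b)` is unique: `(ω₁, ω₂)` is an `𝔽_q`-basis because
`(a, b) ↦ a·ω₁ + b·ω₂` is injective on `𝔽_q × 𝔽_q` (by `h12`) and `#(𝔽_q × 𝔽_q) = q² = #𝓀` (★ `natCard_frobFixed`); non-vanishing from `h02` ∕ `h01` with the coefficient `1`.
[cite: LidlNiederreiter1996, Thm. 2.23 (iii)] [cite: Wilson2009, §3.6 p. 66] -/
theorem exists_fixedPair_of_pairwise_linearIndependent (hk : Fintype.card k = q ^ 2) (σ : k →+* k) (hσ : ∀ x, σ x = x ^ q)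
    (ω₀ ω₁ ω₂ : k)
    (h01 : ∀ a b : k, σ a = a → σ b = b → a * ω₀ + b * ω₁ = 0 → a = 0 ∧ b = 0)
    (h02 : ∀ a b : k, σ a = a → σ b = b → a * ω₀ + b * ω₂ = 0 → a = 0 ∧ b = 0)
    (h12 : ∀ a b : k, σ a = a → σ b = b → a * ω₁ + b * ω₂ = 0 → a = 0 ∧ b = 0) :
    ∃ a b : k, σ a = a ∧ σ b = b ∧ a ≠ 0 ∧ b ≠ 0 ∧ ω₀ + a * ω₁ + b * ω₂ = 0 ∧
      ∀ a' b' : k, σ a' = a' → σ b' = b' → ω₀ + a' * ω₁ + b' * ω₂ = 0 → a' = a ∧ b' = b := by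
  classical
  -- the `𝔽_q`-linear map `Φ : 𝔽_q × 𝔽_q → 𝓀`, `(a, b) ↦ a·ω₁ + b·ω₂`, on σ-fixed pairs
  let Φ : {x : k // σ x = x} × {x : k // σ x = x} → k := fun N => (N.1 : k) * ω₁ + (N.2 : k) * ω₂
  have hΦ : ∀ N : {x : k // σ x = x} × {x : k // σ x = x}, Φ N = (N.1 : k) * ω₁ + (N.2 : k) * ω₂ := fun _ => rfl
  -- injective by the independence of `(ω₁, ω₂)` applied to σ-fixed differences
  have hinj : Function.Injective Φ := by
    rintro ⟨⟨a, ha⟩, ⟨b, hb⟩⟩ ⟨⟨a', ha'⟩, ⟨b', hb'⟩⟩ h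
    rw [hΦ, hΦ] at h
    have h0 : (a - a') * ω₁ + (b - b') * ω₂ = 0 := by linear_combination h
    obtain ⟨h1, h2⟩ := h12 (a - a') (b - b') (by rw [map_sub, ha, ha']) (by rw [map_sub, hb, hb']) h0
    rw [sub_eq_zero] at h1 h2
    subst h1 h2
    rfl
  -- bijective: `#(𝔽_q × 𝔽_q) = q·q = #𝓀`
  have hbij : Function.Bijective Φ := hinj.bijective_of_nat_card_le (le_of_eq (by
    rw [Nat.card_prod, natCard_frobFixed hk σ hσ, Nat.card_eq_fintype_card (α := k), hk, sq]))
  obtain ⟨⟨⟨a, ha⟩, ⟨b, hb⟩⟩, hab⟩ := hbij.2 (-ω₀)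
  rw [hΦ] at hab
  have heq : ω₀ + a * ω₁ + b * ω₂ = 0 := by linear_combination hab
  refine ⟨a, b, ha, hb, ?_, ?_, heq, ?_⟩
  · -- `a ≠ 0`: else `1·ω₀ + b·ω₂ = 0` contradicts the independence of `(ω₀, ω₂)`
    rintro rfl
    exact one_ne_zero (h02 1 b (map_one σ) hb (by linear_combination heq)).1
  · -- `b ≠ 0`: else `1·ω₀ + a·ω₁ = 0` contradicts the independence of `(ω₀, ω₁)`
    rintro rfl
    exact one_ne_zero (h01 1 a (map_one σ) ha (by linear_combination heq)).1
  · -- uniqueness of the σ-fixed pair = injectivity of `Φ`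
    intro a' b' ha' hb' h'
    have hΦeq : Φ (⟨a', ha'⟩, ⟨b', hb'⟩) = Φ (⟨a, ha⟩, ⟨b, hb⟩) := by
      rw [hΦ, hΦ]
      linear_combination h' - heq
    have hNN := hinj hΦeq
    simp only [Prod.mk.injEq, Subtype.mk.injEq] at hNN
    exact hNN

/-- **(H.1) — `∃!` form**: for pairwise `𝔽_q`-independent `ω₀, ω₁, ω₂ ∈ 𝔽_{q²}` there is EXACTLY ONE σ-fixed pair `N = (N.1, N.2)` with `ω₀ + N.1·ω₁ + N.2·ω₂ = 0`
(`𝔽_q` spelled as the σ-fixed subtype `{x // σ x = x}` of ★ `natCard_frobFixed`). [cite: LidlNiederreiter1996, Thm. 2.23 (iii)] -/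
theorem existsUnique_pair_of_pairwise_linearIndependent (hk : Fintype.card k = q ^ 2) (σ : k →+* k) (hσ : ∀ x, σ x = x ^ q)
    (ω₀ ω₁ ω₂ : k)
    (h01 : ∀ a b : k, σ a = a → σ b = b → a * ω₀ + b * ω₁ = 0 → a = 0 ∧ b = 0)
    (h02 : ∀ a b : k, σ a = a → σ b = b → a * ω₀ + b * ω₂ = 0 → a = 0 ∧ b = 0)
    (h12 : ∀ a b : k, σ a = a → σ b = b → a * ω₁ + b * ω₂ = 0 → a = 0 ∧ b = 0) :
    ∃! N : {x : k // σ x = x} × {x : k // σ x = x}, ω₀ + (N.1 : k) * ω₁ + (N.2 : k) * ω₂ = 0 := by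
  obtain ⟨a, b, ha, hb, -, -, heq, huniq⟩ := exists_fixedPair_of_pairwise_linearIndependent hk σ hσ ω₀ ω₁ ω₂ h01 h02 h12
  refine ⟨(⟨a, ha⟩, ⟨b, hb⟩), heq, ?_⟩
  rintro ⟨⟨a', ha'⟩, ⟨b', hb'⟩⟩ h'
  obtain ⟨rfl, rfl⟩ := huniq a' b' ha' hb' h'
  rfl

omit [Fintype k] in
/-- **(H.1) — non-vanishing**: ANY σ-fixed pair `(a, b)` with `ω₀ + a·ω₁ + b·ω₂ = 0` has `a ≠ 0` and `b ≠ 0` (only the pairwise independence of `(ω₀, ω₂)` resp. `(ω₀, ω₁)` is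
used: a vanishing coefficient leaves a relation with the σ-fixed coefficient `1` on `ω₀`). [cite: LidlNiederreiter1996, Thm. 2.23 (iii)] -/
theorem pair_ne_zero_of_pairwise_linearIndependent (σ : k →+* k) (ω₀ ω₁ ω₂ : k)
    (h01 : ∀ a b : k, σ a = a → σ b = b → a * ω₀ + b * ω₁ = 0 → a = 0 ∧ b = 0)
    (h02 : ∀ a b : k, σ a = a → σ b = b → a * ω₀ + b * ω₂ = 0 → a = 0 ∧ b = 0)
    {a b : k} (ha : σ a = a) (hb : σ b = b) (h : ω₀ + a * ω₁ + b * ω₂ = 0) : a ≠ 0 ∧ b ≠ 0 := by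
  refine ⟨?_, ?_⟩
  · rintro rfl
    exact one_ne_zero (h02 1 b (map_one σ) hb (by linear_combination h)).1
  · rintro rfl
    exact one_ne_zero (h01 1 a (map_one σ) ha (by linear_combination h)).1

/-! ### §2 HEAD — the plane residue count `(q + 1)²` -/

/-- **HEAD (H.2) — «THE HERMITIAN PLANE RESIDUE COUNT».**  In `𝓀 = 𝔽_{q²}` (`Fintype.card k = q ^ 2`) with `q`-Frobenius `σ` (`σ x = x ^ q`) and norm `N x = σ x · x`, for
pairwise `𝔽_q`-linearly independent `ω₀, ω₁, ω₂` (σ-fixed-coefficient spelling `h01 h02 h12`):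
`#{(x, y) ∈ 𝓀 × 𝓀 : ω₀ + ω₁·N(x) + ω₂·N(y) = 0} = (q + 1)²` — the fibre is `{x : N x = a} × {y : N y = b}` over the unique σ-fixed pair `(a, b)` of §1 (norms are σ-fixed,
★ `frob_norm`), `a, b ≠ 0`, and each norm sphere has `q + 1` points (★ `natCard_norm_eq`). [cite: Wilson2009, §3.6 p. 66] [cite: LidlNiederreiter1996, Thm. 2.23 (iii)]
[cite: Rogawski1990, §4.9 Prop. 4.9.1 (b) pp. 54–55] -/
theorem natCard_setOf_add_mul_norm_add_mul_norm_eq_zero (hk : Fintype.card k = q ^ 2) (σ : k →+* k) (hσ : ∀ x, σ x = x ^ q)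
    (ω₀ ω₁ ω₂ : k)
    (h01 : ∀ a b : k, σ a = a → σ b = b → a * ω₀ + b * ω₁ = 0 → a = 0 ∧ b = 0)
    (h02 : ∀ a b : k, σ a = a → σ b = b → a * ω₀ + b * ω₂ = 0 → a = 0 ∧ b = 0)
    (h12 : ∀ a b : k, σ a = a → σ b = b → a * ω₁ + b * ω₂ = 0 → a = 0 ∧ b = 0) :
    Nat.card {p : k × k // ω₀ + ω₁ * (σ p.1 * p.1) + ω₂ * (σ p.2 * p.2) = 0} = (q + 1) ^ 2 := by
  obtain ⟨a, b, ha, hb, ha0, hb0, heq, huniq⟩ := exists_fixedPair_of_pairwise_linearIndependent hk σ hσ ω₀ ω₁ ω₂ h01 h02 h12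
  -- the defining relation pins the (σ-fixed) norm pair to `(a, b)`
  have hiff : ∀ p : k × k, ω₀ + ω₁ * (σ p.1 * p.1) + ω₂ * (σ p.2 * p.2) = 0 ↔ σ p.1 * p.1 = a ∧ σ p.2 * p.2 = b := by
    intro p
    constructor
    · intro h
      exact huniq _ _ (frob_norm hk σ hσ p.1) (frob_norm hk σ hσ p.2) (by linear_combination h)
    · rintro ⟨h1, h2⟩
      rw [h1, h2]
      linear_combination heq
  rw [Nat.card_congr ((Equiv.subtypeEquivRight hiff).trans
      (Equiv.subtypeProdEquivProd (p := fun x : k => σ x * x = a) (q := fun y : k => σ y * y = b))), Nat.card_prod,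
    natCard_norm_eq hk σ hσ ha ha0, natCard_norm_eq hk σ hσ hb hb0, sq]

end Summit.HodgeConjecture.HodgeConjecture.R90.S6

end
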